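import Literature.Dynamics.SymbolicDynamics.PeriodicPointFacts
import Literature.Dynamics.SymbolicDynamics.DistortionGluingApps
import Literature.Dynamics.Tilings.OllingerGluing
import HarnessLib

/-!
# Hochman 2025, Thm. 1.1 — proved pieces of the printed proof

`Literature/Dynamics/SymbolicDynamics/PeriodicPointFacts.lean` vendors Hochman's Theorem 1.1 as
the named fact `Hochman2025_existsSIAperiodic` ("for every `d ≥ 2` there exist strongly
irreducible `ℤ^d` subshifts without periodic points"). The printed proof (Discrete Analysis
2025:17) constructs the example for `d = 2` (§§3–6, some thirty pages: the coins-and-buckets game,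
safe points relative to sparse multi-scale rectangle families, certificates of frames and boxes,
and the gluing theorem) and disposes of `d > 2` in one sentence (p. 2): "this implies it for all
`d > 2` by considering the subshifts whose 2-dimensional slices belong to our example."

This file proves that sentence: `Hochman2025_existsSIAperiodic.of_two` reduces the fact to its own
instance `d = 2`. Given a non-empty strongly irreducible subshift `X₂ ⊆ A^{ℤ²}` with gap `g` and
no finite orbits, the *slice subshift*
`sliceSet X₂ = {x : ℤ^d → A | every 2-dimensional slice u ↦ x (w + ι u) lies in X₂}`
(`ι : ℤ² → ℤ^d` the inclusion of the first two coordinates) is again a non-empty subshift, it is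
strongly irreducible with the same gap (the slices through the cosets of `ι(ℤ²)` are independent
and `ι` is an isometry for the sup-metrics, so one glues coset by coset), and a finite `ℤ^d`-orbit
would give the slice through the origin a finite `ℤ²`-orbit.

## Main statements

* `Hochman2025.sliceSet` and its API (`sliceSet_nonempty`, `isSubshift_sliceSet`,
  `isStronglyIrreducible_sliceSet`, `not_hasFiniteOrbit_of_mem_sliceSet`).
* `Hochman2025_existsSIAperiodic.of_two` — the fact follows from its case `d = 2`.

## References

* [Hochman2025] M. Hochman, *Irreducibility and periodicity in `ℤ²` symbolic systems*, Discrete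
  Analysis 2025:17, Thm. 1.1 and the sentence following it (p. 2). Read via
  `lit read arxiv:2401.02273`.
-/

open Set
open _root_.SymbolicDynamics.FullShift

namespace Literature.Dynamics.SymbolicDynamics

namespace Hochman2025

variable {A : Type*} {d : ℕ}

/-! ### Coordinates: `ℤ² ↪ ℤ^d` and the projection back -/

/-- Projection `ℤ^d → ℤ²` onto the first two coordinates (`2 ≤ d`). [folklore] -/
def proj (hd : 2 ≤ d) (v : Fin d → ℤ) : Fin 2 → ℤ :=
  fun j => v (Fin.castLE hd j)

/-- Inclusion `ℤ² → ℤ^d` as the first two coordinates, the others being `0`. [folklore] -/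
def emb (d : ℕ) (u : Fin 2 → ℤ) : Fin d → ℤ :=
  fun i => if h : (i : ℕ) < 2 then u ⟨i, h⟩ else 0

/-- The transversal part of `v : ℤ^d`: `v` with its first two coordinates replaced by `0`,
written as `v - ι (π v)`. [folklore] -/
def transv (hd : 2 ≤ d) (v : Fin d → ℤ) : Fin d → ℤ :=
  v - emb d (proj hd v)

/-- [folklore] -/
@[simp] theorem proj_apply (hd : 2 ≤ d) (v : Fin d → ℤ) (j : Fin 2) :
    proj hd v j = v (Fin.castLE hd j) := rfl

/-- [folklore] -/
theorem emb_apply_castLE (hd : 2 ≤ d) (u : Fin 2 → ℤ) (j : Fin 2) :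
    emb d u (Fin.castLE hd j) = u j := by
  have hj : ((Fin.castLE hd j : Fin d) : ℕ) < 2 := by
    rw [Fin.val_castLE]; exact j.isLt
  simp only [emb, hj, ↓reduceDIte]
  congr 1

/-- `π ∘ ι = id`. [folklore] -/
@[simp] theorem proj_emb (hd : 2 ≤ d) (u : Fin 2 → ℤ) : proj hd (emb d u) = u := by
  funext j
  simp [emb_apply_castLE hd]

/-- [folklore] -/
@[simp] theorem proj_add (hd : 2 ≤ d) (v w : Fin d → ℤ) : proj hd (v + w) = proj hd v + proj hd w :=
  rfl

/-- [folklore] -/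
@[simp] theorem proj_zero (hd : 2 ≤ d) : proj hd (0 : Fin d → ℤ) = 0 := rfl

/-- [folklore] -/
@[simp] theorem emb_add (d : ℕ) (u u' : Fin 2 → ℤ) : emb d (u + u') = emb d u + emb d u' := by
  funext i
  by_cases h : (i : ℕ) < 2 <;> simp [emb, h]

/-- [folklore] -/
@[simp] theorem emb_zero (d : ℕ) : emb d (0 : Fin 2 → ℤ) = 0 := by
  funext i
  by_cases h : (i : ℕ) < 2 <;> simp [emb, h]

/-- `v = τ v + ι (π v)`. [folklore] -/
theorem transv_add_emb_proj (hd : 2 ≤ d) (v : Fin d → ℤ) :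
    transv hd v + emb d (proj hd v) = v :=
  sub_add_cancel v _

/-- Moving inside a slice does not change the transversal part. [folklore] -/
theorem transv_add_emb (hd : 2 ≤ d) (w : Fin d → ℤ) (u : Fin 2 → ℤ) :
    transv hd (w + emb d u) = transv hd w := by
  simp only [transv, proj_add, proj_emb, emb_add]
  abel

/-- `ι` is an isometry for the sup-metrics of `ℤ²` and `ℤ^d`. [folklore] -/
theorem dist_emb_emb (hd : 2 ≤ d) (u u' : Fin 2 → ℤ) : dist (emb d u) (emb d u') = dist u u' := by
  refine le_antisymm ?_ ?_
  · refine (dist_pi_le_iff dist_nonneg).2 fun i => ?_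
    by_cases h : (i : ℕ) < 2
    · simp only [emb, h, ↓reduceDIte]
      exact dist_le_pi_dist u u' ⟨i, h⟩
    · simp [emb, h]
  · refine (dist_pi_le_iff dist_nonneg).2 fun j => ?_
    rw [← emb_apply_castLE hd u j, ← emb_apply_castLE hd u' j]
    exact dist_le_pi_dist _ _ _

/-! ### Slices and the slice subshift -/

/-- The 2-dimensional slice of `x : ℤ^d → A` at offset `w`: `u ↦ x (w + ι u)`.
[cite: Hochman2025, Thm 1.1 (proof sentence, p. 2)] -/
def slice (w : Fin d → ℤ) (x : (Fin d → ℤ) → A) : (Fin 2 → ℤ) → A :=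
  fun u => x (w + emb d u)

/-- [folklore] -/
@[simp] theorem slice_apply (w : Fin d → ℤ) (x : (Fin d → ℤ) → A) (u : Fin 2 → ℤ) :
    slice w x u = x (w + emb d u) := rfl

/-- Hochman's `ℤ^d` example: the configurations all of whose 2-dimensional slices lie in the
`ℤ²` example `X₂` ("the subshifts whose 2-dimensional slices belong to our example").
[cite: Hochman2025, Thm 1.1 (proof sentence, p. 2)] -/
def sliceSet (X₂ : Set ((Fin 2 → ℤ) → A)) : Set ((Fin d → ℤ) → A) :=
  {x | ∀ w : Fin d → ℤ, slice w x ∈ X₂}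

/-- [folklore] -/
theorem mem_sliceSet {X₂ : Set ((Fin 2 → ℤ) → A)} {x : (Fin d → ℤ) → A} :
    x ∈ sliceSet X₂ ↔ ∀ w : Fin d → ℤ, slice w x ∈ X₂ := Iff.rfl

/-- Slices of a shift are slices. [folklore] -/
theorem slice_shift (w v : Fin d → ℤ) (x : (Fin d → ℤ) → A) :
    slice w (shift v x) = slice (v + w) x := by
  funext u
  simp [add_assoc]

/-- Shifting a slice moves its offset inside the coset. [folklore] -/
theorem shift_slice (w : Fin d → ℤ) (x : (Fin d → ℤ) → A) (u : Fin 2 → ℤ) :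
    shift u (slice w x) = slice (w + emb d u) x := by
  funext u'
  simp [add_assoc]

/-- Each slice map is continuous (product topologies). [folklore] -/
theorem continuous_slice [TopologicalSpace A] (w : Fin d → ℤ) :
    Continuous (slice (A := A) w) :=
  continuous_pi fun u => continuous_apply (w + emb d u)

/-- The slice set of a shift-invariant non-empty family is non-empty: the configuration
`v ↦ x₂ (π v)`, constant along the transversal directions, has all its slices equal to shifts of
`x₂`. [cite: Hochman2025, Thm 1.1 (proof sentence, p. 2)] -/
theorem sliceSet_nonempty (hd : 2 ≤ d) {X₂ : Set ((Fin 2 → ℤ) → A)} (hinv : IsShiftInvariant X₂)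
    (hne : X₂.Nonempty) : (sliceSet (d := d) X₂).Nonempty := by
  obtain ⟨x₂, hx₂⟩ := hne
  refine ⟨fun v => x₂ (proj hd v), fun w => ?_⟩
  have : slice w (fun v : Fin d → ℤ => x₂ (proj hd v)) = shift (proj hd w) x₂ := by
    funext u
    simp
  rw [this]
  exact hinv.shift_mem _ hx₂

/-- The slice set of a closed family is closed. [folklore] -/
theorem isClosed_sliceSet [TopologicalSpace A] {X₂ : Set ((Fin 2 → ℤ) → A)} (hcl : IsClosed X₂) :
    IsClosed (sliceSet (d := d) X₂) := by
  have : sliceSet (d := d) X₂ = ⋂ w : Fin d → ℤ, slice w ⁻¹' X₂ := by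
    ext x
    simp [mem_sliceSet]
  rw [this]
  exact isClosed_iInter fun w => hcl.preimage (continuous_slice w)

/-- The slice set is shift-invariant (whatever `X₂` is). [folklore] -/
theorem isShiftInvariant_sliceSet (X₂ : Set ((Fin 2 → ℤ) → A)) :
    IsShiftInvariant (sliceSet (d := d) X₂) := by
  intro v x hx w
  show slice w (shift v x) ∈ X₂
  rw [slice_shift]
  exact hx (v + w)

/-- The slice set of a subshift is a subshift. [cite: Hochman2025, Thm 1.1 (proof sentence, p. 2)] -/
theorem isSubshift_sliceSet [TopologicalSpace A] {X₂ : Set ((Fin 2 → ℤ) → A)} (h : IsSubshift X₂) :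
    IsSubshift (sliceSet (d := d) X₂) :=
  ⟨isClosed_sliceSet h.1, isShiftInvariant_sliceSet X₂⟩

/-- **Strong irreducibility passes to the slice set, with the same gap.** Given `E, F ⊆ ℤ^d` at
sup-distance `> g` and `x, y` in the slice set, for every transversal offset `c` the traces
`{u | c + ι u ∈ E}`, `{u | c + ι u ∈ F}` are at sup-distance `> g` in `ℤ²` (`ι` is an isometry), so
the slices of `x` and `y` at `c` glue to some `z_c ∈ X₂`; the configuration
`v ↦ z_{τ v} (π v)` assembled from one gluing per coset lies in the slice set (its slices are shifts
of the `z_c`, by shift-invariance of `X₂`) and agrees with `x` on `E` and with `y` on `F`.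
[cite: Hochman2025, Thm 1.1 (proof sentence, p. 2)] -/
theorem isStronglyIrreducible_sliceSet (hd : 2 ≤ d) {X₂ : Set ((Fin 2 → ℤ) → A)}
    (hinv : IsShiftInvariant X₂) {g : ℝ} (hSI : IsStronglyIrreducible X₂ g) :
    IsStronglyIrreducible (sliceSet (d := d) X₂) g := by
  intro E F hEF x hx y hy
  -- one gluing problem in `X₂` per offset `c`
  have hglue : ∀ c : Fin d → ℤ, ∃ z ∈ X₂, EqOn z (slice c x) {u | c + emb d u ∈ E} ∧
      EqOn z (slice c y) {u | c + emb d u ∈ F} := by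
    intro c
    refine hSI {u | c + emb d u ∈ E} {u | c + emb d u ∈ F} ?_ (slice c x) (hx c) (slice c y) (hy c)
    intro p hp q hq
    have h := hEF (c + emb d p) hp (c + emb d q) hq
    rwa [dist_add_left, dist_emb_emb hd] at h
  choose z hzX hzx hzy using hglue
  refine ⟨fun v => z (transv hd v) (proj hd v), fun w => ?_, fun v hv => ?_, fun v hv => ?_⟩
  · -- slices of the assembled configuration are shifts of the gluings
    have : slice w (fun v : Fin d → ℤ => z (transv hd v) (proj hd v)) =
        shift (proj hd w) (z (transv hd w)) := by
      funext u
      simp [transv_add_emb hd]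
    rw [this]
    exact hinv.shift_mem _ (hzX _)
  · -- agreement with `x` on `E`
    have hmem : proj hd v ∈ {u | transv hd v + emb d u ∈ E} := by
      show transv hd v + emb d (proj hd v) ∈ E
      rwa [transv_add_emb_proj]
    have := hzx (transv hd v) hmem
    simp only [slice_apply, transv_add_emb_proj] at this
    exact this
  · -- agreement with `y` on `F`
    have hmem : proj hd v ∈ {u | transv hd v + emb d u ∈ F} := by
      show transv hd v + emb d (proj hd v) ∈ F
      rwa [transv_add_emb_proj]
    have := hzy (transv hd v) hmem
    simp only [slice_apply, transv_add_emb_proj] at this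
    exact this

/-- A finite `ℤ^d`-orbit restricts to a finite `ℤ²`-orbit of the slice through the origin:
`shift u (slice 0 x) = slice 0 (shift (ι u) x)`. [folklore] -/
theorem hasFiniteOrbit_slice_zero {x : (Fin d → ℤ) → A} (hx : HasFiniteOrbit x) :
    HasFiniteOrbit (slice (0 : Fin d → ℤ) x) := by
  refine (hx.image (slice (0 : Fin d → ℤ))).subset ?_
  rintro _ ⟨u, rfl⟩
  refine ⟨shift (emb d u) x, ⟨emb d u, rfl⟩, ?_⟩
  show slice 0 (shift (emb d u) x) = shift u (slice 0 x)
  rw [slice_shift, shift_slice, add_zero, zero_add]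

/-- No configuration of the slice set of an aperiodic family has a finite orbit.
[cite: Hochman2025, Thm 1.1 (proof sentence, p. 2)] -/
theorem not_hasFiniteOrbit_of_mem_sliceSet {X₂ : Set ((Fin 2 → ℤ) → A)}
    (hap : ∀ x ∈ X₂, ¬ HasFiniteOrbit x) {x : (Fin d → ℤ) → A} (hx : x ∈ sliceSet X₂) :
    ¬ HasFiniteOrbit x :=
  fun hfin => hap _ (hx 0) (hasFiniteOrbit_slice_zero hfin)

end Hochman2025

/-- **Hochman 2025, Thm. 1.1, reduction to `d = 2`** ("We prove the theorem for `d = 2`, but this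
implies it for all `d > 2` by considering the subshifts whose 2-dimensional slices belong to our
example", p. 2): if there is a non-empty strongly irreducible `ℤ²`-subshift over a finite alphabet
without finite orbits, then `Hochman2025_existsSIAperiodic` holds, the `ℤ^d` example being the
slice subshift `Hochman2025.sliceSet X₂` with the same alphabet and the same gap.
[cite: Hochman2025, Thm 1.1 (p. 2)] -/
theorem Hochman2025_existsSIAperiodic.of_two
    (h₂ : ∃ (k : ℕ) (X : Set ((Fin 2 → ℤ) → Fin k)) (g : ℝ),
      0 ≤ g ∧ X.Nonempty ∧ IsSubshift X ∧ IsStronglyIrreducible X g ∧ ∀ x ∈ X, ¬ HasFiniteOrbit x) :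
    Hochman2025_existsSIAperiodic := by
  intro d hd
  obtain ⟨k, X₂, g, hg, hne, hsub, hSI, hap⟩ := h₂
  exact ⟨k, Hochman2025.sliceSet X₂, g, hg, Hochman2025.sliceSet_nonempty hd hsub.2 hne,
    Hochman2025.isSubshift_sliceSet hsub, Hochman2025.isStronglyIrreducible_sliceSet hd hsub.2 hSI,
    fun x hx => Hochman2025.not_hasFiniteOrbit_of_mem_sliceSet hap hx⟩

/-- The fact is equivalent to its own instance `d = 2`. [cite: Hochman2025, Thm 1.1 (p. 2)] -/
theorem Hochman2025_existsSIAperiodic_iff_two :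
    Hochman2025_existsSIAperiodic ↔
      ∃ (k : ℕ) (X : Set ((Fin 2 → ℤ) → Fin k)) (g : ℝ),
        0 ≤ g ∧ X.Nonempty ∧ IsSubshift X ∧ IsStronglyIrreducible X g ∧
          ∀ x ∈ X, ¬ HasFiniteOrbit x :=
  ⟨fun h => h 2 le_rfl, Hochman2025_existsSIAperiodic.of_two⟩

end Literature.Dynamics.SymbolicDynamics

/-!
# Gangloff–Sablik Thm. 26: an aperiodic linearly block gluing `ℤ²`-SFT exists

Proof of the named fact `GangloffSablik2021_aperiodic`
(`Literature/Dynamics/SymbolicDynamics/PeriodicPointFacts.lean`), following the architecture of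
Gangloff–Sablik §5.4 with ONE substitution: the rigid input subshift is Ollinger's aperiodic
`2 × 2`-substitution SFT (`Literature/Dynamics/Tilings/Ollinger*.lean`: non-empty, of finite
type, aperiodic, and linearly NET gluing by its global hierarchy, `ollinger_netGluing`) instead
of the Robinson subshift with its alignment layer (§§3–4.3 of the source, not formalised). Then,
exactly as printed (§5.4.3): the distortion operator `d_A` (`DistortionOperator.lean`) preserves
non-emptiness, finite type (`isSFT_distortion`) and aperiodicity (`isAperiodic_distortion`,
Prop. 27), turns net gluing into column gluing (`colGluing_distortion`, Lemma 10 with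
Props. 31–32), a quarter turn turns columns into rows (`rowGluing_rotSet`), and a second
application of `d_A` turns row gluing into linear block gluing
(`isLinearlyBlockGluing_distortion`); finally the finite alphabet is relabelled to `Fin k`.

## References

* S. Gangloff, M. Sablik, *Quantified block gluing for multidimensional subshifts of finite type:
  aperiodicity and entropy*, J. Anal. Math. 144 (2021) 21–118, Thm. 26 and §5.4
  (arXiv:1706.01627).
* N. Ollinger, *Two-by-Two Substitution Systems and the Undecidability of the Domino Problem*,
  CiE 2008, LNCS 5028 (the input SFT).
-/

namespace Literature.Dynamics.SymbolicDynamics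

open _root_.SymbolicDynamics.FullShift
open Literature.Dynamics.Tilings

/-- The Ollinger subshift is shift-invariant. [cite: Ollinger2008, §2] -/
theorem isShiftInvariant_ollingerShift : IsShiftInvariant Ollinger.ollingerShift :=
  fun v _ hx => Ollinger.isOTiling_shift hx v

/-- The Ollinger subshift is linearly net gluing (constant `512`). [cite: GangloffSablik2021, Def. 13; Ollinger2008, §3] -/
theorem netGluing_ollingerShift : Distortion.NetGluing Ollinger.ollingerShift 512 :=
  fun m hm => Ollinger.ollinger_netGluing m hm

/-- **Gangloff–Sablik, Thm. 26: there is a non-empty aperiodic linearly block gluing `ℤ²`-SFT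
over a finite alphabet.** [cite: GangloffSablik2021, Thm. 26 (§5.4; arXiv:1706.01627 numbering)] -/
theorem GangloffSablik2021_aperiodic_holds : GangloffSablik2021_aperiodic := by
  classical
  -- the input: Ollinger's aperiodic SFT, linearly net gluing
  have hX₀ne := Ollinger.ollingerShift_nonempty
  have hX₀sft := Ollinger.isSFT_ollingerShift
  have hX₀ap := Ollinger.isAperiodic_ollingerShift
  have hX₀sh := isShiftInvariant_ollingerShift
  -- first distortion: column gluing; quarter turn: row gluing
  have hZ₁col := Distortion.colGluing_distortion hX₀sh netGluing_ollingerShift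
  have hZ₁sh := Distortion.isShiftInvariant_distortion hX₀sh
  have hY₂row := Distortion.rowGluing_rotSet hZ₁sh hZ₁col
  have hY₂sh := Distortion.isShiftInvariant_rotSet hZ₁sh
  -- second distortion: linearly block gluing, still a non-empty aperiodic SFT
  set Z₃ := Distortion.distortion (Distortion.rotSet (Distortion.distortion Ollinger.ollingerShift))
    with hZ₃
  have hZ₃bg : IsLinearlyBlockGluing Z₃ := Distortion.isLinearlyBlockGluing_distortion hY₂sh hY₂row
  have hZ₃ne : Z₃.Nonempty := Distortion.distortion_nonempty
    (Distortion.rotSet_nonempty (Distortion.distortion_nonempty hX₀ne))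
  have hZ₃sft : IsSFT Z₃ := Distortion.isSFT_distortion
    (Distortion.isSFT_rotSet (Distortion.isSFT_distortion hX₀sft))
  have hZ₃ap : IsAperiodic Z₃ := Distortion.isAperiodic_distortion
    (Distortion.isAperiodic_rotSet (Distortion.isAperiodic_distortion hX₀ap))
  -- relabel the finite alphabet
  let e := Fintype.equivFin (Option (Option Ollinger.GoodTile))
  obtain ⟨z₀, hz₀⟩ := hZ₃ne
  refine ⟨_, {x' | ⇑e.symm ∘ x' ∈ Z₃}, ⟨⇑e ∘ z₀, ?_⟩, hZ₃sft.comp_alphabet e.symm,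
    hZ₃ap.comp_alphabet e.symm, hZ₃bg.comp_alphabet_equiv e⟩
  show ⇑e.symm ∘ (⇑e ∘ z₀) ∈ Z₃
  have h : ⇑e.symm ∘ (⇑e ∘ z₀) = z₀ := by
    funext w
    simp
  rw [h]
  exact hz₀

end Literature.Dynamics.SymbolicDynamics
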